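import Summits.HodgeConjecture.CorCM.CyclicSexticHodgeRungOfMarkman
import Summits.HodgeConjecture.CorCM.CyclotomicSliceZeta7CMType
import Summits.HodgeConjecture.CorCM.Geometry.BallQuotientUniformisedHolds
import Summits.HodgeConjecture.CorCM.Census.DeligneWeilFamilyZeta7
import HarnessLib

/-!
# COR-CM: the slice of `HC_CM = CMAbelianHodge` at a Galois SEXTIC CM field, GIVEN MARKMAN'S FOURFOLD THEOREM —
# the A1 rung in the summit's own binder language

Cell `pub-hodgecm2` (COR-CM = stage 2 of the Hodge ladder), seat b30 gen 12 (2026-08-21); COUNT-NEUTRAL (no row of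
`HOME/BINDER-OWNERS.md`); theorems only, no definition, no named fact, no `sorry`.

Seat b30 gen 11's rung (`CorCM/CyclicSexticHodgeRungOfMarkman.lean`) proves, given the displayed named fact
`Markman2025_weilClasses_algebraic_abelianFourfold` only, the Hodge conjecture for every complex abelian variety
DOMINATED BY a product of realisations `(B, ι, θ)` of CM types of CM fields embeddable in a Galois sextic CM field `K`
(`…_of_avDominatedBy_cmProdAV_sextic_of_markman'`, `…_isProductOf_sextic_of_markman`).  Here the same slice is
stated with the hypothesis of the summit statement `HC_CM := Theses.RankFourFaces.CMAbelianHodge` —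
`Milne1999.IsOfCMType A` («`End⁰(A)` contains a commutative reduced `ℚ`-subalgebra of degree `2 dim A`») — and ONE
intrinsic side condition, exactly as in seat b04's `ℚ(ζ₇)` slice `CorCM/CyclotomicSliceZeta7CMType.lean`
(pattern followed verbatim, Fermat/Aoki replaced by Markman): every SIMPLE ABELIAN SUBVARIETY `B ↪ A` of positive
dimension has `End⁰(B) →+* K` (for simple CM `B`, `End⁰(B)` is a CM field of degree `2 dim B`; so: CM by the
imaginary quadratic subfield of `K` or by `K` itself).

* `exists_avDominatedBy_cmProdAV_of_isOfCMType_of_endAlgebra` — RECORD-FREE and for EVERY CM field `K`: a complex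
  abelian variety `A` of CM type and positive dimension whose simple abelian subvarieties have `End⁰ →+* K` is
  dominated by a product `∏_j A_{(K,Θ_j)} = Domination.cmProdAV K cmAbelianVarietyRealised_holds n Θ` of the chosen
  realisations of CM types of `K`: hereditary Poincaré decomposition
  (`AbelianVariety.exists_isogeny_from_productOf_simple_pos_of_hereditary`, Mumford §19), CM type of simple abelian
  subvarieties (`isOfCMType_of_isSimple_of_isClosedImmersion`), `End⁰(B)` a CM field (Shimura §5.1 Prop. 5 /
  Deligne I 5.1 at Riemann's theorem `deligneMilne1982_Thm_6_20_full_holds`), a principal model in the isogeny class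
  (`h7_holds`, Shimura §7.1 Prop. 7) realising the CM type `cmTypeOfPair` on `H¹` (§5.2), Shimura's inflation to `K`
  (`Domination.exists_avDominatedBy_cmProdAV_of_isCMTypeRealisation_of_embedding`, §6.2 Thm. 3 + §6.1 Cor.) and
  re-association of products (`Domination.exists_avDominatedBy_cmProdAV_of_isProductOf`).
* `hodgeConjectureFor_of_isOfCMType_of_endAlgebra_sextic_of_markman` — **for `K` Galois sextic, HC for every complex
  abelian variety of CM type whose simple abelian subvarieties have `End⁰ →+* K`, GIVEN MARKMAN ONLY** (dimension `0`:
  the tree's unconditional HC in dimension `≤ 3`; positive dimension: the previous theorem and the rung at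
  `hU := BallQuotient.ballQuotientUniformisedDatum_holds`);
  `hodgeConjectureFor_of_avDominatedBy_isOfCMType_sextic_of_markman` — and for everything dominated by such an `A`;
* `cmAbelianHodge_slice_sextic_of_markman` — the same with the two binders of `CMAbelianHodge` displayed VERBATIM
  (`IsSmoothProjective A.dim A.X`, `∃ S : Subalgebra ℚ A.endAlgebra, IsReduced S ∧ S commutative ∧ finrank ℚ S = 2·dim A`).

## References
* [Markman2025SurveySecant] E. Markman, arXiv:2509.23403, Thm. 1.2 (the displayed hypothesis).
* [Shimura1998] G. Shimura, *Abelian Varieties with Complex Multiplication and Modular Functions* (1998), §5.1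
  Props. 3–6, §5.2, §6.1 Cor., §6.2 Thm. 3, §7.1 Prop. 7.
* [MumfordAV1970] D. Mumford, *Abelian Varieties*, §19 Thm. 1 and Cor. 1.
* [Milne1999] J. S. Milne, Compositio Math. 117 (1999), §2 p. 54 (CM type).
* [Andre1992HodgeCM] Y. André, Progr. Math. 102 (1992), Théorème (pp. 4–5).
-/

noncomputable section

open CategoryTheory NumberField AlgebraicGeometry
open Literature.AlgebraicGeometry Literature.AlgebraicGeometry.Motives Literature.AlgebraicGeometry.HodgeTheory
open Literature.AlgebraicGeometry.ComplexMultiplication Literature.AlgebraicGeometry.Milne1999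
open Literature.NumberTheory.ComplexMultiplication (isCMTypeRealisation_cmTypeOfPair)
open Summit.HodgeConjecture.CorCM.Domination

namespace Summit.HodgeConjecture.CorCM.CyclicSextic

/-! ## §1 Domination by `∏_j A_{(K,Θ_j)}` from the End-algebra condition (every CM field `K`, record-free) -/

section AnyCMField

variable {K : Type} [Field K] [NumberField K] [IsCMField K]

/-- **A simple complex abelian variety of CM type with `End⁰ →+* K` is dominated by some `∏_j A_{(K,Θ_j)}`**
(hypothesis-free: Riemann's theorem and the realisation record are the tree's theorems
`deligneMilne1982_Thm_6_20_full_holds`, `cmAbelianVarietyRealised_holds`).  `End⁰(B)` made a field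
`E = EndField B hF` is CM (Shimura §5.1 Prop. 5), Prop. 7 of §7.1 (`h7_holds`) gives a principal model
`(B′, φ′, ι′)` isogenous to `B` realising the CM type `cmTypeOfPair φ′` of `E` on `H¹` (§5.2), and Shimura's
inflation along `E →+* K` dominates `B′` by the chosen realisation of the induced type (§6.2 Thm. 3, §6.1 Cor.).
[cite: Shimura1998, §5.1 Propositions 3–6, §5.2, §7.1 Proposition 7, §6.2 Theorem 3]
[cite: DeligneMilne1982Tannakian, §6 Thm. 6.20 (Riemann)] -/
theorem exists_avDominatedBy_cmProdAV_of_isSimple_of_endAlgebra {B : AbelianVariety ℂ}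
    (hB : AbelianVariety.IsSimple B) (hB0 : 0 < B.dim) (hCM : IsOfCMType B) (k : B.endAlgebra →+* K) :
    ∃ (n : ℕ) (Θ : Fin (n + 1) → CMType K), AVDominatedBy B (cmProdAV K cmAbelianVarietyRealised_holds n Θ) := by
  have hF : IsField B.endAlgebra := (hCM.isOfCMTypeSimple hB hB0).1
  have hdeg : Module.finrank ℚ B.endAlgebra = 2 * B.dim := (hCM.isOfCMTypeSimple hB hB0).2
  haveI : IsCMField (EndField B hF) :=
    isCMField_endField_of_isSimple_of_riemann deligneMilne1982_Thm_6_20_full_holds hB hB0 hCM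
  -- Shimura §7.1 Prop. 7: a principal model in the isogeny class
  obtain ⟨B', φ', ι', hφι, f, hf⟩ := h7_holds B hB hB0 hCM hF
  have hdim' : Module.finrank ℚ (EndField B hF) = 2 * B'.dim := by
    rw [EndField.finrank_eq, hdeg, AbelianVariety.dim_eq_of_isIsogeny hf]
  -- `(B′, ι′)` realises the CM type of `(B′, φ′)` on `H¹`
  have hreal := isCMTypeRealisation_cmTypeOfPair φ' hdim' ι' hφι
  -- inflation along `E = End⁰(B) →+* K`
  obtain ⟨n, Θ, hB'⟩ := exists_avDominatedBy_cmProdAV_of_isCMTypeRealisation_of_embedding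
    cmAbelianVarietyRealised_holds
    (thm3_isogenousPower_of_riemann deligneMilne1982_Thm_6_20_full_holds cmAbelianVarietyRealised_holds)
    (thm2_cor_of_riemann deligneMilne1982_Thm_6_20_full_holds)
    (k.comp (EndField.toEndAlgebra hF).toRingHom) hreal
  exact ⟨n, Θ, AVDominatedBy.of_isIsogenous ⟨f, hf⟩ hB'⟩

/-- **Every complex abelian variety of CM type (positive dimension) whose simple abelian subvarieties have
`End⁰ →+* K` is dominated by some `∏_j A_{(K,Θ_j)}`** — for EVERY CM field `K`, record-free.  Hereditary Poincaré
decomposition `P → A` (isogeny from a product of simple abelian SUBVARIETIES of positive dimension), CM type of the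
simple abelian subvarieties, the previous theorem at each factor, and re-association of the products over `K`.
[cite: MumfordAV1970, §19 Thm. 1, Cor. 1 (pp. 173–174)] [cite: Shimura1998, §5.1, §6.2 Theorem 3, §7.1 Proposition 7] -/
theorem exists_avDominatedBy_cmProdAV_of_isOfCMType_of_endAlgebra {A : AbelianVariety ℂ} (hA0 : 0 < A.dim)
    (hCM : IsOfCMType A)
    (hend : ∀ (B : AbelianVariety ℂ) (f : B ⟶ A), IsClosedImmersion (AbelianVariety.Hom.toSchemeHom f) →
      AbelianVariety.IsSimple B → 0 < B.dim → Nonempty (B.endAlgebra →+* K)) :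
    ∃ (n : ℕ) (Θ : Fin (n + 1) → CMType K), AVDominatedBy A (cmProdAV K cmAbelianVarietyRealised_holds n Θ) := by
  obtain ⟨P, g, hP, hg⟩ :=
    AbelianVariety.exists_isogeny_from_productOf_simple_pos_of_hereditary
      (fun B => ∃ f : B ⟶ A, IsClosedImmersion (AbelianVariety.Hom.toSchemeHom f))
      (fun B C f hf ⟨i, hi⟩ => ⟨f ≫ i, by
        haveI := hf; haveI := hi
        change IsClosedImmersion (AbelianVariety.Hom.toSchemeHom f ≫ AbelianVariety.Hom.toSchemeHom i)
        infer_instance⟩)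
      A ⟨𝟙 A, by change IsClosedImmersion (𝟙 A.X.left); infer_instance⟩ hA0
  have hP' : AbelianVariety.IsProductOf (fun B : AbelianVariety ℂ =>
      ∃ (n : ℕ) (Θ : Fin (n + 1) → CMType K), AVDominatedBy B (cmProdAV K cmAbelianVarietyRealised_holds n Θ)) P :=
    hP.mono fun B ⟨hs, hB0, i, hi⟩ => by
      haveI := hi
      obtain ⟨k⟩ := hend B i hi hs hB0
      exact exists_avDominatedBy_cmProdAV_of_isSimple_of_endAlgebra hs hB0
        (isOfCMType_of_isSimple_of_isClosedImmersion hCM hs i) k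
  obtain ⟨n, Θ, hPd⟩ := exists_avDominatedBy_cmProdAV_of_isProductOf cmAbelianVarietyRealised_holds hP'
  exact ⟨n, Θ, (AVDominatedBy.of_isIsogeny_inv hg (AVDominatedBy.refl P)).trans hPd⟩

end AnyCMField

/-! ## §2 Galois sextic `K`: the slice of `HC_CM`, given Markman's fourfold theorem only -/

section Sextic

variable {K : Type} [Field K] [NumberField K] [IsCMField K] [IsGalois ℚ K]

/-- **HC for every complex abelian variety OF CM TYPE whose simple abelian subvarieties have `End⁰ →+* K`, `K` a
Galois SEXTIC CM field, GIVEN MARKMAN'S FOURFOLD THEOREM ONLY** (`Milne1999.IsOfCMType A`, the displayed hypothesis of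
`Theses.RankFourFaces.CMAbelianHodge`; the side condition says: CM by the imaginary quadratic subfield of `K` or by
`K`).  Dimension `0`: the tree's unconditional HC in dimension `≤ 3`; positive dimension:
`exists_avDominatedBy_cmProdAV_of_isOfCMType_of_endAlgebra` and seat b30's rung
`hodgeConjectureFor_of_avDominatedBy_cmProdAV_sextic_of_markman'` at `hU := BallQuotient.ballQuotientUniformisedDatum_holds`
(no model record displayed). [cite: Markman2025SurveySecant, Thm. 1.2] [cite: Andre1992HodgeCM, Théorème (pp. 4–5)]
[cite: Shimura1998, §5.1 Propositions 3–6, §5.2, §6.2 Theorem 3, §7.1 Proposition 7] [cite: MumfordAV1970, §19]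
[cite: Milne1999, §2 p. 54] -/
theorem hodgeConjectureFor_of_isOfCMType_of_endAlgebra_sextic_of_markman
    (hW4 : Markman2025_weilClasses_algebraic_abelianFourfold) (h6 : Module.finrank ℚ K = 6)
    {A : AbelianVariety ℂ} (hCM : IsOfCMType A)
    (hend : ∀ (B : AbelianVariety ℂ) (f : B ⟶ A), IsClosedImmersion (AbelianVariety.Hom.toSchemeHom f) →
      AbelianVariety.IsSimple B → 0 < B.dim → Nonempty (B.endAlgebra →+* K)) :
    HodgeConjectureFor A.dim A.X := by
  rcases Nat.eq_zero_or_pos A.dim with hA0 | hA0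
  · exact hodgeConjectureFor_of_dim_le_three_holds (by omega) (AbelianVariety.isSmoothProjective_holds (A := A))
  · obtain ⟨n, Θ, hdom⟩ := exists_avDominatedBy_cmProdAV_of_isOfCMType_of_endAlgebra hA0 hCM hend
    exact hodgeConjectureFor_of_avDominatedBy_cmProdAV_sextic_of_markman'
      BallQuotient.ballQuotientUniformisedDatum_holds hW4 ⟨K⟩ h6 A hdom

/-- **Everything dominated by such an `A` satisfies HC** (isogeny factors, isogenous abelian varieties, quotients),
given Markman's fourfold theorem. [cite: Markman2025SurveySecant, Thm. 1.2] [cite: MumfordAV1970, §19] -/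
theorem hodgeConjectureFor_of_avDominatedBy_isOfCMType_sextic_of_markman
    (hW4 : Markman2025_weilClasses_algebraic_abelianFourfold) (h6 : Module.finrank ℚ K = 6)
    {A C : AbelianVariety ℂ} (hA0 : 0 < A.dim) (hCM : IsOfCMType A)
    (hend : ∀ (B : AbelianVariety ℂ) (f : B ⟶ A), IsClosedImmersion (AbelianVariety.Hom.toSchemeHom f) →
      AbelianVariety.IsSimple B → 0 < B.dim → Nonempty (B.endAlgebra →+* K))
    (hC : AVDominatedBy C A) : HodgeConjectureFor C.dim C.X := by
  obtain ⟨n, Θ, hdom⟩ := exists_avDominatedBy_cmProdAV_of_isOfCMType_of_endAlgebra hA0 hCM hend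
  exact hodgeConjectureFor_of_avDominatedBy_cmProdAV_sextic_of_markman'
    BallQuotient.ballQuotientUniformisedDatum_holds hW4 ⟨K⟩ h6 C (hC.trans hdom)

/-- **`CMAbelianHodge` (= `HC_CM`) restricted to a Galois sextic CM field, hypotheses displayed VERBATIM, given
Markman's fourfold theorem.**  With the two binders of
`Summit.HodgeConjecture.HodgeConjecture.Theses.RankFourFaces.CMAbelianHodge` written exactly as there
(`IsSmoothProjective A.dim A.X` and `∃ S : Subalgebra ℚ A.endAlgebra, IsReduced S ∧ S commutative ∧
finrank ℚ S = 2 · dim A`) plus the intrinsic condition «every simple abelian subvariety of positive dimension has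
`End⁰ →+* K`», the conclusion `HodgeConjectureFor A.dim A.X` holds — the only displayed input being
`Markman2025_weilClasses_algebraic_abelianFourfold` (Weil classes on abelian FOURFOLDS of Weil type).
[cite: Markman2025SurveySecant, Thm. 1.2] [cite: Andre1992HodgeCM, Théorème (pp. 4–5)]
[cite: Shimura1998, §5.1, §6.2 Theorem 3, §7.1 Proposition 7] [cite: Milne1999, §2 p. 54] -/
theorem cmAbelianHodge_slice_sextic_of_markman (hW4 : Markman2025_weilClasses_algebraic_abelianFourfold)
    (h6 : Module.finrank ℚ K = 6) :
    ∀ A : AbelianVariety ℂ, IsSmoothProjective A.dim A.X →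
      (∃ S : Subalgebra ℚ A.endAlgebra,
        IsReduced ↥S ∧ (∀ x ∈ S, ∀ y ∈ S, x * y = y * x) ∧ Module.finrank ℚ ↥S = 2 * A.dim) →
      (∀ (B : AbelianVariety ℂ) (f : B ⟶ A), IsClosedImmersion (AbelianVariety.Hom.toSchemeHom f) →
        AbelianVariety.IsSimple B → 0 < B.dim → Nonempty (B.endAlgebra →+* K)) →
      HodgeConjectureFor A.dim A.X :=
  fun _ _ hCM hend => hodgeConjectureFor_of_isOfCMType_of_endAlgebra_sextic_of_markman hW4 h6 hCM hend

end Sextic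

/-! ## v2 (seat b30 gen 12) — §3 The two cyclotomic sextic slices `ℚ(ζ₇)`, `ℚ(ζ₉)` by the MARKMAN road

Seat b04's `CyclotomicSliceZeta7CMType` / `CyclotomicSliceZeta9CMType` prove these slices modulo the two AOKI records
(`Aoki2002_hodgeClasses_algebraic_fermatJacobianPowers`, `Aoki2002_fermatFactor_cmTypeOf`) and a Jacobian of the Fermat
curve; `ℚ(ζ₇)` and `ℚ(ζ₉)` being Galois sextic CM fields, §2 gives the same slices by an INDEPENDENT road whose only
displayed input is Markman's fourfold theorem — and at `ℚ(ζ₉)` with the weaker side condition `End⁰(B) →+* F`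
(CM by `ℚ(√-3)` allowed) in place of `End⁰(B) ≃+* F`. -/

section Cyclotomic

variable {F : Type} [Field F] [NumberField F] [IsCMField F]

omit [IsCMField F] in
/-- `[F : ℚ] = φ(9) = 6` for `F ≅ ℚ(ζ₉)`. [folklore] -/
private theorem finrank_eq_six_of_isCyclotomicExtension_nine [IsCyclotomicExtension {9} ℚ F] :
    Module.finrank ℚ F = 6 := by
  rw [IsCyclotomicExtension.finrank F (Polynomial.cyclotomic.irreducible_rat (by norm_num : 0 < 9))]
  decide

/-- **The `ℚ(ζ₇)` slice of `CMAbelianHodge` by the Markman road**: for `F ≅ ℚ(ζ₇)`, every complex abelian variety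
of CM type whose simple abelian subvarieties have `End⁰ →+* F` (CM by `ℚ(√-7)` or `ℚ(ζ₇)`) satisfies the Hodge
conjecture, GIVEN ONLY `Markman2025_weilClasses_algebraic_abelianFourfold` (compare seat b04's
`CyclotomicSlice.cmAbelianHodge_slice_seven`: the same conclusion modulo the two Aoki records).
[cite: Markman2025SurveySecant, Thm. 1.2] [cite: Shimura1998, §5.1, §6.2 Theorem 3, §7.1 Proposition 7] -/
theorem cmAbelianHodge_slice_cyclotomic_seven_of_markman [IsCyclotomicExtension {7} ℚ F]
    (hW4 : Markman2025_weilClasses_algebraic_abelianFourfold) :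
    ∀ A : AbelianVariety ℂ, IsSmoothProjective A.dim A.X →
      (∃ S : Subalgebra ℚ A.endAlgebra,
        IsReduced ↥S ∧ (∀ x ∈ S, ∀ y ∈ S, x * y = y * x) ∧ Module.finrank ℚ ↥S = 2 * A.dim) →
      (∀ (B : AbelianVariety ℂ) (f : B ⟶ A), IsClosedImmersion (AbelianVariety.Hom.toSchemeHom f) →
        AbelianVariety.IsSimple B → 0 < B.dim → Nonempty (B.endAlgebra →+* F)) →
      HodgeConjectureFor A.dim A.X :=
  haveI : IsGalois ℚ F := IsCyclotomicExtension.isGalois {7} ℚ F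
  cmAbelianHodge_slice_sextic_of_markman hW4 (Census.DeligneWeilFamilyZeta7.finrank_eq_six F)

/-- **The `ℚ(ζ₉)` slice of `CMAbelianHodge` by the Markman road**: for `F ≅ ℚ(ζ₉)`, every complex abelian variety
of CM type whose simple abelian subvarieties have `End⁰ →+* F` (CM by `ℚ(√-3)` or `ℚ(ζ₉)`) satisfies the Hodge
conjecture, GIVEN ONLY Markman's fourfold theorem (compare seat b04's `cmAbelianHodge_slice_nine`, modulo the Aoki
records and with the stronger side condition `End⁰(B) ≃+* F`).
[cite: Markman2025SurveySecant, Thm. 1.2] [cite: Shimura1998, §5.1, §6.2 Theorem 3, §7.1 Proposition 7] -/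
theorem cmAbelianHodge_slice_cyclotomic_nine_of_markman [IsCyclotomicExtension {9} ℚ F]
    (hW4 : Markman2025_weilClasses_algebraic_abelianFourfold) :
    ∀ A : AbelianVariety ℂ, IsSmoothProjective A.dim A.X →
      (∃ S : Subalgebra ℚ A.endAlgebra,
        IsReduced ↥S ∧ (∀ x ∈ S, ∀ y ∈ S, x * y = y * x) ∧ Module.finrank ℚ ↥S = 2 * A.dim) →
      (∀ (B : AbelianVariety ℂ) (f : B ⟶ A), IsClosedImmersion (AbelianVariety.Hom.toSchemeHom f) →
        AbelianVariety.IsSimple B → 0 < B.dim → Nonempty (B.endAlgebra →+* F)) →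
      HodgeConjectureFor A.dim A.X :=
  haveI : IsGalois ℚ F := IsCyclotomicExtension.isGalois {9} ℚ F
  cmAbelianHodge_slice_sextic_of_markman hW4 finrank_eq_six_of_isCyclotomicExtension_nine

end Cyclotomic

end Summit.HodgeConjecture.CorCM.CyclicSextic

end
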